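import Summits.ValiantsHypothesis.ValiantsHypothesis.Theorems.GrenetZeonDualUnipotentThreeHalvesLongMassDeepMode
import Summits.ValiantsHypothesis.ValiantsHypothesis.Theorems.GrenetZeonDualUnipotentThreeHalvesLongMassSubmoduleShadow

/-!
# `GrenetZeon.DualUnipotentThreeHalves` (stmt-ValiantsHypothesis-24318), line `slow_core`, stub (c) `SlowCore.LongMassSlowLawInv`:
# LOW-ORDER CERTIFICATES, EXPLICITLY — order `0` forces `W = 0`, order `1` forces `W² = 0` and `W·V·W = 0` (submodule currency)

By-name corollaries of the two lower-side instruments ✓ `pow_eq_zero_of_window` (index shadow) and ✓ `oneLetterWord_eq_zero_of_window`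
(one-letter mixed words), spelling out what the cheapest certificate orders mean for a nilpotent `V ≤ M_b(ℂ)`:

* ★ `eq_bot_of_window_zero` — an order-`0` certificate (window `n ≥ 2`) has `W = ⊥`: its price is `dim V` (order `0` = FREEZE, nothing else).
* ★★ `mul_mul_eq_zero_of_window_one` — an order-`1` certificate (window `n ≥ 4`) has `w² = 0` AND `w · A · w = 0` for all `w ∈ W`, `A ∈ V`
  (the one-letter word at `m = 2` is `A w² + w A w + w² A`).  So order-`1` directions form a square-zero space `W` with `W·V·W = 0` — the exact
  habitat of the square-zero gauge cones (census row r4) — and an order-`1` certificate of price `≤ P` needs such a `W ≤ V` of codimension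
  `≤ P − n`.

Honest framing.  Instruments (`--supports stmt-ValiantsHypothesis-24318`), NOT progress on (c): (c) `SlowCore.LongMassSlowLawInv`, S3, the crux
24318, 8062 and `VP ≠ VNP` remain OPEN / NOT proved.  No sorry, no definitions, no named facts.
-/

-- single-conjunct layout: Sub = Summit, duplicated namespace component intended (the name is mandated)
set_option linter.dupNamespace false
set_option autoImplicit false

noncomputable section

namespace Summit.ValiantsHypothesis.ValiantsHypothesis.Theorems.GrenetZeon.LongMassHomogenise

open MvPolynomial Matrix
open scoped BigOperators

variable {b : ℕ}

/-- ★ **ORDER `0` IS FREEZE**: an order-`0` certificate at window `n ≥ 2` has no directions. -/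
theorem eq_bot_of_window_zero (V W : Submodule ℂ (Matrix (Fin b) (Fin b) ℂ)) {n : ℕ} (hn : 2 ≤ n)
    (hwin : ∀ A ∈ V, ∀ w ∈ W, ∀ p : ℕ, p ≤ n - 1 → ∀ i j : Fin b,
      ((((A.map (C : ℂ → MvPolynomial (Fin 1) ℂ) + (X 0 : MvPolynomial (Fin 1) ℂ) • w.map C) ^ p :
        Matrix (Fin b) (Fin b) (MvPolynomial (Fin 1) ℂ)) i j).totalDegree ≤ 0)) :
    W = ⊥ := by
  rw [Submodule.eq_bot_iff]
  intro w hw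
  have h := pow_eq_zero_of_window V W (k := 0) (by omega) hwin hw
  rwa [zero_add, pow_one] at h

/-- ★★ **ORDER `1`: `W² = 0` AND `W·V·W = 0`.**  An order-`1` certificate at window `n ≥ 4` has square-zero directions which, moreover,
annihilate the base space from both sides: `w · A · w = 0` for all `w ∈ W`, `A ∈ V`. -/
theorem mul_mul_eq_zero_of_window_one (V W : Submodule ℂ (Matrix (Fin b) (Fin b) ℂ)) {n : ℕ} (hn : 4 ≤ n)
    (hwin : ∀ A ∈ V, ∀ w ∈ W, ∀ p : ℕ, p ≤ n - 1 → ∀ i j : Fin b,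
      ((((A.map (C : ℂ → MvPolynomial (Fin 1) ℂ) + (X 0 : MvPolynomial (Fin 1) ℂ) • w.map C) ^ p :
        Matrix (Fin b) (Fin b) (MvPolynomial (Fin 1) ℂ)) i j).totalDegree ≤ 1))
    {A w : Matrix (Fin b) (Fin b) ℂ} (hA : A ∈ V) (hw : w ∈ W) : w * w = 0 ∧ w * A * w = 0 := by
  have hsq : w ^ 2 = 0 := pow_eq_zero_of_window V W (k := 1) (by omega) hwin hw
  have hsq' : w * w = 0 := by rwa [pow_two] at hsq
  refine ⟨hsq', ?_⟩
  have h := oneLetterWord_eq_zero_of_window V W hwin hA hw (m := 2) (by omega) (by omega)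
  -- `Σ_{l ≤ 2} w^l A w^{2-l} = A w² + w A w + w² A`
  rw [Finset.sum_range_succ, Finset.sum_range_succ, Finset.sum_range_one] at h
  have e1 : w ^ 0 * A * w ^ (2 - 0) = 0 := by rw [show (2 : ℕ) - 0 = 2 from rfl, hsq, Matrix.mul_zero]
  have e2 : w ^ 1 * A * w ^ (2 - 1) = w * A * w := by rw [show (2 : ℕ) - 1 = 1 from rfl, pow_one]
  have e3 : w ^ 2 * A * w ^ (2 - 2) = 0 := by rw [hsq, Matrix.zero_mul, Matrix.zero_mul]
  rw [e1, e2, e3, zero_add, add_zero] at h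
  exact h

end Summit.ValiantsHypothesis.ValiantsHypothesis.Theorems.GrenetZeon.LongMassHomogenise

end
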